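import Mathlib.Analysis.CStarAlgebra.Matrix
import Mathlib.LinearAlgebra.Matrix.NonsingularInverse

/-!
# `BalabanUV.Beta.GAN24.BorderedFrameInverse` — binder row G-an2-4 / (CONV-C), road P1-fibre, typer row **P1-E1** (DAG node N10c, ENGINE of the
# A4′(iii) mechanism of `SKELETON-P1.md`): the ABSTRACT bordered-matrix inverse in a frame, and the NEUMANN step, over Mathlib only

NOT IN PRINT; OUR PROOF ATTEMPT (of the road; THIS file is [folklore] finite-dimensional linear algebra).  HONEST FRAMING (cell contract, verbatim):
«discharging `BetaPertH` makes Bałaban's UV stability UNCONDITIONAL — a real constructive-QFT result; it is NOT the continuum limit and NOT the Clay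
problem.»  HONEST DEPENDENCY (verbatim): «continuum YM on T⁴ ⇐ BetaPertH ∧ nine spine estimates (0/9 proved); BetaPertH ⇐ (D1) ∧ (D4) ∧ CAP+tail;
G-an2-4 gates asym, D1 and NE2/3/4.»  An engine lemma: no cited fact, no wall binder, no `def … : Prop` hypothesis; it discharges NOTHING of the K-slot
of (CONV-C); NOT summit progress.  Consumer: typer row P1-L08d (`GAN24/CapInverseSmall`), which applies it to the SCALED capacitance
`diag(√λ·1, λ) · cap N p · diag(√λ·1, λ) / N^(D+4)` of row P1-T00 (A4′(iii): `τ ≈ 1/2`, `|α|, |β| ≍ 1`, `‖E‖ = O(λ)`).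

## Setting and what is proved
Index `ι ⊕ Unit` (the `φ`-block `ι`, the gauge constant `c`), scalars `ℂ`, norms = the OPERATOR NORM W.R.T. THE EUCLIDEAN NORM (Mathlib's scoped
`Matrix.Norms.L2Operator` instances; vectors as `EuclideanSpace ℂ _`, i.e. `‖toLp 2 x‖ = √(Σ ‖x i‖²)`).  A unit vector `u : ι → ℂ` (`star u ⬝ᵥ u = 1`), the
rank-one projector `uuH u = u uᴴ`, and a «transverse» matrix `P` with `P u = 0`, `uᴴ P = 0`.
* §1 Euclidean operator-norm toolkit (on top of Mathlib's `Matrix.l2_opNorm_mulVec`, `‖A x‖ ≤ ‖A‖‖x‖`): `norm_dotProduct_mulVec_le`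
  (`|xᴴ A y| ≤ ‖x‖‖A‖‖y‖`), `norm_entry_le` (`|A i j| ≤ ‖A‖`), `isUnit_of_mulVec_eq_zero` (injective ⇒ invertible), `sum_norm_sq_eq_norm_toLp`.
* §2 NEUMANN STEP `neumann` (any square index): `IsUnit C₀`, `‖E‖·‖C₀⁻¹‖ ≤ 1/2` ⇒ `IsUnit (C₀ + E)`, `‖(C₀+E)⁻¹‖ ≤ 2‖C₀⁻¹‖`,
  `‖(C₀+E)⁻¹ − C₀⁻¹‖ ≤ 2‖C₀⁻¹‖²‖E‖` (no series: injectivity + the resolvent identity `Matrix.inv_sub_inv`).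
* §3 FRAME MODEL `frameModel P u ε α β = fromBlocks (P + ε • uuH u) (col (α • u)) (row (β • star u)) 0` and its EXPLICIT INVERSE
  `frameInv P u ε α β = fromBlocks (pinvT P u) (col (β⁻¹ • u)) (row (α⁻¹ • star u)) (−ε/(αβ))` with the transverse pseudo-inverse
  `pinvT P u = (P + uuH u)⁻¹ − uuH u` (= the inverse of `P` on `u⊥`, extended by `0`): under `P u = 0`, `uᴴ P = 0`, injectivity of `P` on `u⊥` and `α β ≠ 0`:
  `pinvT_mulVec_u`/`u_vecMul_pinvT` (`P⁺u = 0`, `uᴴP⁺ = 0`), `mul_pinvT`/`pinvT_mul` (`P P⁺ = P⁺ P = 1 − uuᴴ`), `frameModel_mul_frameInv` (`C₀ C₀⁻¹ = 1`),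
  `isUnit_frameModel`, `inv_frameModel` — for ANY `ε` (ε need not be small).
* §4 COERCIVITY ⇒ bounds: if `τ · Σ_i ‖x i‖² ≤ Re (xᴴ P x)` for all `x ⊥ u` (i.e. `uᴴx = 0`; `τ > 0`) then `P` is injective on `u⊥` (`inj_of_coercive`) and `‖pinvT P u‖ ≤ 1/τ`
  (`norm_pinvT_le`).
The blockwise corollaries of §2+§3 (`(⊥⊥) = P⁺ + O(‖E‖)`, `uu = O(‖E‖)`, `(u,c) = 1/β + O`, `(c,u) = 1/α + O`, `(c,c) = −ε/(αβ) + O`) and the bound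
`‖frameInv‖ ≤ 1/τ + 1/|α| + 1/|β| + |ε|/|αβ|` are in the companion file `GAN24/BorderedFrameInverseBlocks`.
-/

open Matrix WithLp Complex
open scoped ComplexConjugate Matrix.Norms.L2Operator InnerProductSpace

namespace Summit.QuantumFields.BalabanUV.Beta.GAN24.BorderedFrameInverse

/-! ### §1 Euclidean operator-norm toolkit for complex matrices -/
section L2Tools

variable {m n : Type*} [Fintype m] [Fintype n]

/-- [folklore] The sesquilinear pairing is the inner product: `star x ⬝ᵥ (A y) = ⟪x, A y⟫`. -/
theorem star_dotProduct_mulVec_eq_inner (A : Matrix m n ℂ) (x : EuclideanSpace ℂ m) (y : EuclideanSpace ℂ n) :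
    star (ofLp x) ⬝ᵥ (A *ᵥ ofLp y) = ⟪x, (toLp 2 (A *ᵥ ofLp y) : EuclideanSpace ℂ m)⟫_ℂ := by
  rw [EuclideanSpace.inner_eq_star_dotProduct, dotProduct_comm]

/-- [folklore] In the Euclidean norm, `‖x‖ ≤ c‖x‖` with `c < 1` forces `x = 0`. -/
theorem eq_zero_of_norm_toLp_le {x : n → ℂ} {c : ℝ} (hc : c < 1)
    (h : ‖(toLp 2 x : EuclideanSpace ℂ n)‖ ≤ c * ‖(toLp 2 x : EuclideanSpace ℂ n)‖) : x = 0 := by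
  have h0 : ‖(toLp 2 x : EuclideanSpace ℂ n)‖ = 0 := by
    nlinarith [norm_nonneg (toLp 2 x : EuclideanSpace ℂ n)]
  have := norm_eq_zero.1 h0
  simpa using congrArg ofLp this

/-- [folklore] `Σ_i ‖x i‖² = ‖x‖₂²` (bridge between the cell's sum currency and `EuclideanSpace`). -/
theorem sum_norm_sq_eq_norm_toLp (x : n → ℂ) : ∑ i, ‖x i‖ ^ 2 = ‖(toLp 2 x : EuclideanSpace ℂ n)‖ ^ 2 :=
  (EuclideanSpace.norm_sq_eq _).symm

variable [DecidableEq n]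

/-! The two basic facts `‖A x‖₂ ≤ ‖A‖‖x‖₂` and «`‖A‖ ≤ C` if `‖A x‖₂ ≤ C‖x‖₂` for all `x`» are Mathlib's `Matrix.l2_opNorm_mulVec` and
`Matrix.l2_opNorm_def` + `ContinuousLinearMap.opNorm_le_bound` (stated as named theorems in `Literature.Computability.QuantumComplexity.PlaceGateNorm`;
used inline here to keep this file's imports inside Mathlib). -/

/-- [folklore] `|xᴴ A y| ≤ ‖x‖ ‖A‖ ‖y‖`. -/
theorem norm_dotProduct_mulVec_le (A : Matrix m n ℂ) (x : EuclideanSpace ℂ m) (y : EuclideanSpace ℂ n) :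
    ‖star (ofLp x) ⬝ᵥ (A *ᵥ ofLp y)‖ ≤ ‖x‖ * (‖A‖ * ‖y‖) := by
  rw [star_dotProduct_mulVec_eq_inner]
  exact (norm_inner_le_norm _ _).trans (by gcongr; exact Matrix.l2_opNorm_mulVec A y)

/-- [folklore] Every entry is bounded by the operator norm: `|A i j| ≤ ‖A‖`. -/
theorem norm_entry_le [DecidableEq m] (A : Matrix m n ℂ) (i : m) (j : n) : ‖A i j‖ ≤ ‖A‖ := by
  have h := norm_dotProduct_mulVec_le A (PiLp.single 2 i (1 : ℂ)) (PiLp.single 2 j (1 : ℂ))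
  have hs : star (ofLp (PiLp.single 2 i (1 : ℂ) : EuclideanSpace ℂ m)) = Pi.single i 1 := by
    ext k; simp [Pi.single_apply, apply_ite star]
  rw [hs, PiLp.ofLp_single, mulVec_single_one, single_one_dotProduct, PiLp.norm_single, PiLp.norm_single,
    norm_one, one_mul, mul_one] at h
  exact h

/-- [folklore] A square complex matrix with trivial kernel is invertible. -/
theorem isUnit_of_mulVec_eq_zero {A : Matrix n n ℂ} (h : ∀ x : n → ℂ, A *ᵥ x = 0 → x = 0) : IsUnit A :=
  Matrix.mulVec_injective_iff_isUnit.1 fun x y hxy =>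
    sub_eq_zero.1 (h _ (by rw [mulVec_sub, hxy, sub_self]))

end L2Tools

/-! ### §2 The Neumann step -/
section Neumann

variable {n : Type*} [Fintype n] [DecidableEq n]

/-- [folklore] **NEUMANN STEP** (finite-dimensional, Euclidean operator norm, no series).  If `C₀` is invertible and `‖E‖·‖C₀⁻¹‖ ≤ 1/2` then `C₀ + E` is
invertible, `‖(C₀+E)⁻¹‖ ≤ 2‖C₀⁻¹‖` and `‖(C₀+E)⁻¹ − C₀⁻¹‖ ≤ 2‖C₀⁻¹‖²‖E‖`.  Proof: a kernel vector `x` of `C₀ + E` satisfies `x = −C₀⁻¹E x`, so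
`‖x‖ ≤ ‖x‖/2`; then the resolvent identity `(C₀+E)⁻¹ − C₀⁻¹ = −(C₀+E)⁻¹ E C₀⁻¹` (`Matrix.inv_sub_inv`). -/
theorem neumann {C₀ E : Matrix n n ℂ} (hC₀ : IsUnit C₀) (h : ‖E‖ * ‖C₀⁻¹‖ ≤ 1 / 2) :
    IsUnit (C₀ + E) ∧ ‖(C₀ + E)⁻¹‖ ≤ 2 * ‖C₀⁻¹‖ ∧ ‖(C₀ + E)⁻¹ - C₀⁻¹‖ ≤ 2 * ‖C₀⁻¹‖ ^ 2 * ‖E‖ := by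
  have hdet : IsUnit C₀.det := (isUnit_iff_isUnit_det _).1 hC₀
  have hU : IsUnit (C₀ + E) := by
    refine isUnit_of_mulVec_eq_zero fun x hx => ?_
    have hx' : x = -((C₀⁻¹ * E) *ᵥ x) := by
      have h1 : C₀⁻¹ *ᵥ ((C₀ + E) *ᵥ x) = 0 := by rw [hx, mulVec_zero]
      rw [add_mulVec, mulVec_add, mulVec_mulVec, nonsing_inv_mul _ hdet, one_mulVec, mulVec_mulVec] at h1
      exact eq_neg_of_add_eq_zero_left h1
    refine eq_zero_of_norm_toLp_le (c := 1 / 2) (by norm_num) ?_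
    calc ‖(toLp 2 x : EuclideanSpace ℂ n)‖
        = ‖(toLp 2 ((C₀⁻¹ * E) *ᵥ ofLp (toLp 2 x : EuclideanSpace ℂ n)) : EuclideanSpace ℂ n)‖ := by
          rw [ofLp_toLp]
          conv_lhs => rw [hx']
          rw [toLp_neg, norm_neg]
      _ ≤ ‖C₀⁻¹ * E‖ * ‖(toLp 2 x : EuclideanSpace ℂ n)‖ := Matrix.l2_opNorm_mulVec _ _
      _ ≤ ‖C₀⁻¹‖ * ‖E‖ * ‖(toLp 2 x : EuclideanSpace ℂ n)‖ := by
          gcongr; exact norm_mul_le _ _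
      _ ≤ 1 / 2 * ‖(toLp 2 x : EuclideanSpace ℂ n)‖ := by
          gcongr; rw [mul_comm]; exact h
  have hRB : (C₀ + E)⁻¹ - C₀⁻¹ = -((C₀ + E)⁻¹ * E * C₀⁻¹) := by
    rw [Matrix.inv_sub_inv (iff_of_true hU hC₀), sub_add_cancel_left, Matrix.mul_neg, Matrix.neg_mul]
  have h1 : ‖(C₀ + E)⁻¹ - C₀⁻¹‖ ≤ ‖(C₀ + E)⁻¹‖ * ‖E‖ * ‖C₀⁻¹‖ := by
    rw [hRB, norm_neg]; exact norm_mul₃_le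
  have h2 : ‖(C₀ + E)⁻¹‖ ≤ ‖C₀⁻¹‖ + ‖(C₀ + E)⁻¹ - C₀⁻¹‖ := norm_le_insert' _ _
  have hb := norm_nonneg C₀⁻¹
  have hr := norm_nonneg (C₀ + E)⁻¹
  have he := norm_nonneg E
  have h3 : ‖(C₀ + E)⁻¹‖ * ‖E‖ * ‖C₀⁻¹‖ ≤ ‖(C₀ + E)⁻¹‖ * (1 / 2) := by
    rw [mul_assoc]; exact mul_le_mul_of_nonneg_left h hr
  have hR : ‖(C₀ + E)⁻¹‖ ≤ 2 * ‖C₀⁻¹‖ := by linarith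
  refine ⟨hU, hR, h1.trans ?_⟩
  calc ‖(C₀ + E)⁻¹‖ * ‖E‖ * ‖C₀⁻¹‖ ≤ 2 * ‖C₀⁻¹‖ * ‖E‖ * ‖C₀⁻¹‖ := by gcongr
    _ = 2 * ‖C₀⁻¹‖ ^ 2 * ‖E‖ := by ring

end Neumann

/-! ### §3 The frame model and its explicit inverse (pure algebra) -/
section Frame

variable {ι : Type*} [Fintype ι]

/-- [folklore] The rank-one matrix `u uᴴ` (`(uuH u) i j = u i * conj (u j)`); the orthogonal projector onto `span u` when `uᴴu = 1`. -/
def uuH (u : ι → ℂ) : Matrix ι ι ℂ := vecMulVec u (star u)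

/-- [folklore] `(uuᴴ) v = (uᴴv) u`. -/
theorem uuH_mulVec (u v : ι → ℂ) : uuH u *ᵥ v = (star u ⬝ᵥ v) • u := by
  rw [uuH, vecMulVec_mulVec, op_smul_eq_smul]

/-- [folklore] `vᵀ (uuᴴ) = (vᵀu) uᴴ`. -/
theorem vecMul_uuH (v u : ι → ℂ) : v ᵥ* uuH u = (v ⬝ᵥ u) • star u := by
  rw [uuH, vecMul_vecMulVec]

/-- [folklore] `M (uuᴴ) = (Mu) uᴴ`. -/
theorem mul_uuH (M : Matrix ι ι ℂ) (u : ι → ℂ) : M * uuH u = vecMulVec (M *ᵥ u) (star u) := by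
  rw [uuH, mul_vecMulVec]

/-- [folklore] `(uuᴴ) M = u (uᴴM)`. -/
theorem uuH_mul (u : ι → ℂ) (M : Matrix ι ι ℂ) : uuH u * M = vecMulVec u (star u ᵥ* M) := by
  rw [uuH, vecMulVec_mul]

/-- [folklore] `uuᴴ` is idempotent when `uᴴu = 1`. -/
theorem uuH_mul_uuH {u : ι → ℂ} (hu : star u ⬝ᵥ u = 1) : uuH u * uuH u = uuH u := by
  rw [uuH, vecMulVec_mul_vecMulVec, hu, one_smul]

/-- [folklore] The FRAME MODEL `C₀ = [[P + ε u uᴴ, α u], [β uᴴ, 0]]` on `ι ⊕ Unit` (A4′(iii): transverse block `P`, longitudinal entry `ε`,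
border `α u`, `β uᴴ`, zero `cc` entry). -/
def frameModel (P : Matrix ι ι ℂ) (u : ι → ℂ) (ε α β : ℂ) : Matrix (ι ⊕ Unit) (ι ⊕ Unit) ℂ :=
  fromBlocks (P + ε • uuH u) (replicateCol Unit (α • u)) (replicateRow Unit (β • star u)) 0

variable [DecidableEq ι]

/-- [folklore] The TRANSVERSE PSEUDO-INVERSE `P⁺ := (P + u uᴴ)⁻¹ − u uᴴ`: when `P u = 0`, `uᴴ P = 0` and `P` is injective on `u⊥`, this is the inverse
of `P|_{u⊥} : u⊥ → u⊥` extended by `0` on `span u` (`mul_pinvT`, `pinvT_mul`, `pinvT_mulVec_u`, `u_vecMul_pinvT`). -/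
noncomputable def pinvT (P : Matrix ι ι ℂ) (u : ι → ℂ) : Matrix ι ι ℂ := (P + uuH u)⁻¹ - uuH u

/-- [folklore] The EXPLICIT INVERSE of the frame model: `[[P⁺, β⁻¹ u], [α⁻¹ uᴴ, −ε/(αβ)]]`. -/
noncomputable def frameInv (P : Matrix ι ι ℂ) (u : ι → ℂ) (ε α β : ℂ) : Matrix (ι ⊕ Unit) (ι ⊕ Unit) ℂ :=
  fromBlocks (pinvT P u) (replicateCol Unit (β⁻¹ • u)) (replicateRow Unit (α⁻¹ • star u)) (of fun _ _ => -(ε / (α * β)))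

variable {P : Matrix ι ι ℂ} {u : ι → ℂ}

omit [DecidableEq ι] in
/-- [folklore] `(P + uuᴴ) u = u`. -/
theorem aug_mulVec_u (hu : star u ⬝ᵥ u = 1) (hPu : P *ᵥ u = 0) : (P + uuH u) *ᵥ u = u := by
  rw [add_mulVec, hPu, uuH_mulVec, hu, one_smul, zero_add]

omit [DecidableEq ι] in
/-- [folklore] `uᴴ (P + uuᴴ) = uᴴ`. -/
theorem u_vecMul_aug (hu : star u ⬝ᵥ u = 1) (huP : star u ᵥ* P = 0) : star u ᵥ* (P + uuH u) = star u := by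
  rw [vecMul_add, huP, vecMul_uuH, hu, one_smul, zero_add]

/-- [folklore] `P + uuᴴ` is invertible as soon as `P` is injective on `u⊥` (and `uᴴP = 0`, `uᴴu = 1`). -/
theorem isUnit_aug (hu : star u ⬝ᵥ u = 1) (huP : star u ᵥ* P = 0)
    (hinj : ∀ x : ι → ℂ, star u ⬝ᵥ x = 0 → P *ᵥ x = 0 → x = 0) : IsUnit (P + uuH u) := by
  refine isUnit_of_mulVec_eq_zero fun x hx => ?_
  rw [add_mulVec, uuH_mulVec] at hx
  have hc : star u ⬝ᵥ x = 0 := by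
    have := congrArg (fun y => star u ⬝ᵥ y) hx
    simp only [dotProduct_add, dotProduct_smul, dotProduct_mulVec, huP, zero_dotProduct, zero_add, hu,
      smul_eq_mul, mul_one, dotProduct_zero] at this
    exact this
  rw [hc, zero_smul, add_zero] at hx
  exact hinj x hc hx

/-- [folklore] `(P + uuᴴ)⁻¹ u = u`. -/
theorem augInv_mulVec_u (hu : star u ⬝ᵥ u = 1) (hPu : P *ᵥ u = 0) (hA : IsUnit (P + uuH u)) :
    (P + uuH u)⁻¹ *ᵥ u = u := by
  have hdet : IsUnit (P + uuH u).det := (isUnit_iff_isUnit_det _).1 hA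
  have h := congrArg (fun v => (P + uuH u)⁻¹ *ᵥ v) (aug_mulVec_u hu hPu)
  simp only [mulVec_mulVec, nonsing_inv_mul _ hdet, one_mulVec] at h
  exact h.symm

/-- [folklore] `uᴴ (P + uuᴴ)⁻¹ = uᴴ`. -/
theorem u_vecMul_augInv (hu : star u ⬝ᵥ u = 1) (huP : star u ᵥ* P = 0) (hA : IsUnit (P + uuH u)) :
    star u ᵥ* (P + uuH u)⁻¹ = star u := by
  have hdet : IsUnit (P + uuH u).det := (isUnit_iff_isUnit_det _).1 hA
  have h := congrArg (fun v => v ᵥ* (P + uuH u)⁻¹) (u_vecMul_aug hu huP)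
  simp only [vecMul_vecMul, mul_nonsing_inv _ hdet, vecMul_one] at h
  exact h.symm

/-- [folklore] `P⁺ u = 0`. -/
theorem pinvT_mulVec_u (hu : star u ⬝ᵥ u = 1) (hPu : P *ᵥ u = 0) (hA : IsUnit (P + uuH u)) :
    pinvT P u *ᵥ u = 0 := by
  rw [pinvT, sub_mulVec, augInv_mulVec_u hu hPu hA, uuH_mulVec, hu, one_smul, sub_self]

/-- [folklore] `uᴴ P⁺ = 0`. -/
theorem u_vecMul_pinvT (hu : star u ⬝ᵥ u = 1) (huP : star u ᵥ* P = 0) (hA : IsUnit (P + uuH u)) :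
    star u ᵥ* pinvT P u = 0 := by
  rw [pinvT, vecMul_sub, u_vecMul_augInv hu huP hA, vecMul_uuH, hu, one_smul, sub_self]

/-- [folklore] `P P⁺ = 1 − uuᴴ` (the orthogonal projector onto `u⊥`). -/
theorem mul_pinvT (hu : star u ⬝ᵥ u = 1) (hPu : P *ᵥ u = 0) (huP : star u ᵥ* P = 0) (hA : IsUnit (P + uuH u)) :
    P * pinvT P u = 1 - uuH u := by
  have hdet : IsUnit (P + uuH u).det := (isUnit_iff_isUnit_det _).1 hA
  have h1 : P * (P + uuH u)⁻¹ = 1 - uuH u := by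
    have : P * (P + uuH u)⁻¹ = ((P + uuH u) - uuH u) * (P + uuH u)⁻¹ := by rw [add_sub_cancel_right]
    rw [this, sub_mul, mul_nonsing_inv _ hdet, uuH_mul, u_vecMul_augInv hu huP hA, ← uuH]
  have h2 : P * uuH u = 0 := by rw [mul_uuH, hPu, zero_vecMulVec]
  rw [pinvT, mul_sub, h1, h2, sub_zero]

/-- [folklore] `P⁺ P = 1 − uuᴴ`. -/
theorem pinvT_mul (hu : star u ⬝ᵥ u = 1) (hPu : P *ᵥ u = 0) (huP : star u ᵥ* P = 0) (hA : IsUnit (P + uuH u)) :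
    pinvT P u * P = 1 - uuH u := by
  have hdet : IsUnit (P + uuH u).det := (isUnit_iff_isUnit_det _).1 hA
  have h1 : (P + uuH u)⁻¹ * P = 1 - uuH u := by
    have : (P + uuH u)⁻¹ * P = (P + uuH u)⁻¹ * ((P + uuH u) - uuH u) := by rw [add_sub_cancel_right]
    rw [this, mul_sub, nonsing_inv_mul _ hdet, mul_uuH, augInv_mulVec_u hu hPu hA, ← uuH]
  have h2 : uuH u * P = 0 := by rw [uuH_mul, huP, vecMulVec_zero]
  rw [pinvT, sub_mul, h1, h2, sub_zero]

/-- [folklore] **THE FRAME MODEL TIMES ITS EXPLICIT INVERSE IS THE IDENTITY** (any `ε`; `α, β ≠ 0`). -/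
theorem frameModel_mul_frameInv (hu : star u ⬝ᵥ u = 1) (hPu : P *ᵥ u = 0) (huP : star u ᵥ* P = 0)
    (hA : IsUnit (P + uuH u)) {ε α β : ℂ} (hα : α ≠ 0) (hβ : β ≠ 0) :
    frameModel P u ε α β * frameInv P u ε α β = 1 := by
  rw [frameModel, frameInv, fromBlocks_multiply, ← fromBlocks_one]
  congr 1
  · -- (P + ε uuᴴ) P⁺ + (α u)(α⁻¹ uᴴ) = (1 − uuᴴ) + uuᴴ
    rw [add_mul, smul_mul, mul_pinvT hu hPu huP hA, uuH_mul, u_vecMul_pinvT hu huP hA,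
      vecMulVec_zero, smul_zero, add_zero, ← vecMulVec_eq Unit, smul_vecMulVec, vecMulVec_smul, smul_smul,
      mul_inv_cancel₀ hα, one_smul, ← uuH, sub_add_cancel]
  · -- (P + ε uuᴴ)(β⁻¹ u) + (α u)(−ε/(αβ)) = 0
    rw [← replicateCol_mulVec, mulVec_smul, add_mulVec, hPu, smul_mulVec, uuH_mulVec, hu, one_smul, zero_add]
    ext i j
    simp only [Matrix.add_apply, replicateCol_apply, Pi.smul_apply, smul_eq_mul, Matrix.mul_apply, of_apply,
      Finset.univ_unique, Finset.sum_singleton, Matrix.zero_apply]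
    field_simp
    ring
  · -- (β uᴴ) P⁺ + 0 = 0
    rw [Matrix.zero_mul, add_zero, ← replicateRow_vecMul, smul_vecMul, u_vecMul_pinvT hu huP hA, smul_zero,
      replicateRow_zero]
  · -- (β uᴴ)(β⁻¹ u) + 0 = 1
    rw [Matrix.zero_mul, add_zero]
    ext i j
    simp only [replicateRow_mul_replicateCol_apply, smul_dotProduct, dotProduct_smul, hu, smul_eq_mul, mul_one,
      Matrix.one_apply, if_true]
    exact inv_mul_cancel₀ hβ

/-- [folklore] The frame model is invertible (any `ε`; `α, β ≠ 0`; `P` injective on `u⊥`). -/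
theorem isUnit_frameModel (hu : star u ⬝ᵥ u = 1) (hPu : P *ᵥ u = 0) (huP : star u ᵥ* P = 0)
    (hA : IsUnit (P + uuH u)) {ε α β : ℂ} (hα : α ≠ 0) (hβ : β ≠ 0) : IsUnit (frameModel P u ε α β) :=
  (isUnit_iff_isUnit_det _).2 (isUnit_det_of_right_inverse (frameModel_mul_frameInv hu hPu huP hA hα hβ))

/-- [folklore] `C₀⁻¹ = frameInv` (Mathlib's `Matrix.inv`). -/
theorem inv_frameModel (hu : star u ⬝ᵥ u = 1) (hPu : P *ᵥ u = 0) (huP : star u ᵥ* P = 0)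
    (hA : IsUnit (P + uuH u)) {ε α β : ℂ} (hα : α ≠ 0) (hβ : β ≠ 0) :
    (frameModel P u ε α β)⁻¹ = frameInv P u ε α β :=
  inv_eq_right_inv (frameModel_mul_frameInv hu hPu huP hA hα hβ)

/-- [folklore] `frameInv * C₀ = 1` as well. -/
theorem frameInv_mul_frameModel (hu : star u ⬝ᵥ u = 1) (hPu : P *ᵥ u = 0) (huP : star u ᵥ* P = 0)
    (hA : IsUnit (P + uuH u)) {ε α β : ℂ} (hα : α ≠ 0) (hβ : β ≠ 0) :
    frameInv P u ε α β * frameModel P u ε α β = 1 := by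
  rw [← inv_frameModel hu hPu huP hA hα hβ]
  exact nonsing_inv_mul _ ((isUnit_iff_isUnit_det _).1 (isUnit_frameModel hu hPu huP hA hα hβ))

end Frame

/-! ### §4 Transverse coercivity ⇒ injectivity on `u⊥` and `‖P⁺‖ ≤ 1/τ` -/
section Coercive

variable {ι : Type*} [Fintype ι] {P : Matrix ι ι ℂ} {u : ι → ℂ} {τ : ℝ}

/-- [folklore] `Re (xᴴ x) = Σ ‖x i‖² = ‖x‖₂²`. -/
theorem re_star_dotProduct_self (x : ι → ℂ) :
    (star x ⬝ᵥ x).re = ‖(toLp 2 x : EuclideanSpace ℂ ι)‖ ^ 2 := by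
  rw [EuclideanSpace.norm_sq_eq, dotProduct, Complex.re_sum]
  refine Finset.sum_congr rfl fun i _ => ?_
  rw [Pi.star_apply, ofLp_toLp, Complex.star_def, Complex.conj_mul', ← Complex.ofReal_pow, Complex.ofReal_re]

/-- [folklore] Transverse coercivity `τ‖x‖² ≤ Re(xᴴ P x)` on `u⊥` with `τ > 0` makes `P` injective on `u⊥`. -/
theorem inj_of_coercive (hτ : 0 < τ)
    (hco : ∀ x : ι → ℂ, star u ⬝ᵥ x = 0 → τ * (∑ i, ‖x i‖ ^ 2) ≤ (star x ⬝ᵥ (P *ᵥ x)).re)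
    (x : ι → ℂ) (hx : star u ⬝ᵥ x = 0) (hPx : P *ᵥ x = 0) : x = 0 := by
  have h := hco x hx
  rw [hPx, dotProduct_zero, Complex.zero_re, sum_norm_sq_eq_norm_toLp] at h
  have h0 : ‖(toLp 2 x : EuclideanSpace ℂ ι)‖ ^ 2 ≤ 0 := by nlinarith
  have : ‖(toLp 2 x : EuclideanSpace ℂ ι)‖ = 0 := by nlinarith [norm_nonneg (toLp 2 x : EuclideanSpace ℂ ι)]
  simpa using congrArg ofLp (norm_eq_zero.1 this)

variable [DecidableEq ι]

/-- [folklore] **`‖P⁺‖ ≤ 1/τ`** under transverse coercivity (`τ > 0`, `P u = 0`, `uᴴ P = 0`, `uᴴ u = 1`). -/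
theorem norm_pinvT_le (hu : star u ⬝ᵥ u = 1) (hPu : P *ᵥ u = 0) (huP : star u ᵥ* P = 0) (hτ : 0 < τ)
    (hco : ∀ x : ι → ℂ, star u ⬝ᵥ x = 0 → τ * (∑ i, ‖x i‖ ^ 2) ≤ (star x ⬝ᵥ (P *ᵥ x)).re) :
    ‖pinvT P u‖ ≤ 1 / τ := by
  have hA : IsUnit (P + uuH u) := isUnit_aug hu huP (inj_of_coercive hτ hco)
  rw [Matrix.l2_opNorm_def]
  refine ContinuousLinearMap.opNorm_le_bound _ (by positivity) fun y => ?_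
  change ‖(toLp 2 (pinvT P u *ᵥ ofLp y) : EuclideanSpace ℂ ι)‖ ≤ 1 / τ * ‖y‖
  set x : ι → ℂ := pinvT P u *ᵥ ofLp y with hxdef
  have hx : star u ⬝ᵥ x = 0 := by rw [hxdef, dotProduct_mulVec, u_vecMul_pinvT hu huP hA, zero_dotProduct]
  have hPx : P *ᵥ x = ofLp y - (star u ⬝ᵥ ofLp y) • u := by
    rw [hxdef, mulVec_mulVec, mul_pinvT hu hPu huP hA, sub_mulVec, one_mulVec, uuH_mulVec]
  have hxu : star x ⬝ᵥ u = 0 := by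
    rw [show u = star (star u) from (star_star u).symm, star_dotProduct_star, hx, star_zero]
  have hcs : ‖star x ⬝ᵥ ofLp y‖ ≤ ‖(toLp 2 x : EuclideanSpace ℂ ι)‖ * ‖y‖ := by
    have : star x ⬝ᵥ ofLp y = ⟪(toLp 2 x : EuclideanSpace ℂ ι), y⟫_ℂ := by
      rw [EuclideanSpace.inner_eq_star_dotProduct, dotProduct_comm, ofLp_toLp]
    rw [this]; exact norm_inner_le_norm _ _
  have h1 : (star x ⬝ᵥ (P *ᵥ x)).re ≤ ‖(toLp 2 x : EuclideanSpace ℂ ι)‖ * ‖y‖ := by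
    rw [hPx, dotProduct_sub, dotProduct_smul, hxu, smul_zero, sub_zero]
    exact (Complex.re_le_norm _).trans hcs
  have h2 := hco x hx
  rw [sum_norm_sq_eq_norm_toLp] at h2
  -- τ ‖x‖² ≤ ‖x‖ ‖y‖  ⇒  ‖x‖ ≤ ‖y‖ / τ
  have hxn := norm_nonneg (toLp 2 x : EuclideanSpace ℂ ι)
  have hyn := norm_nonneg y
  rw [one_div, inv_mul_eq_div, le_div_iff₀ hτ]
  by_cases h0 : ‖(toLp 2 x : EuclideanSpace ℂ ι)‖ = 0
  · rw [h0, zero_mul]; exact hyn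
  · have hpos : 0 < ‖(toLp 2 x : EuclideanSpace ℂ ι)‖ := lt_of_le_of_ne hxn (Ne.symm h0)
    nlinarith

end Coercive

end Summit.QuantumFields.BalabanUV.Beta.GAN24.BorderedFrameInverse
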